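import Mathlib
import Literature.NumberTheory.LFunctions.Zhang2022.TypedSection16BLocal
import Literature.NumberTheory.LFunctions.Zhang2022.AppendixALemma161Steps
import Literature.NumberTheory.Automorphic.AutomorphicLFunctionSplittingProofs
import HarnessLib

/-!
# Zhang (2022) §16 p. 93: "`ϖ₂ⱼ(n)` is multiplicative" — the kernel form `ϖ₂ⱼ(n₁n) = ϖ₂ⱼ(n₁)·ϖ₂ⱼ^loc(n)`
# (finding F16B-1 of the ZHANG-L lane), with the locality and convergence of the Euler factors of `𝓜₂`

Topic `Literature/NumberTheory/LFunctions/Zhang2022` (Landau–Siegel audit tree; verdict-neutral).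
Y. Zhang, *Discrete mean estimates and the Landau–Siegel zero*, arXiv:2211.02515v1 (2022)
[Zhang2022LandauSiegel] — **an unrefereed manuscript under adjudication; nothing here asserts or denies
its Theorems 1–2.** THEOREMS ONLY about the typed objects of `Typed.Section16A` (`calM2Factor`, `calM2`,
`calM2star`, `lam2`), `Typed.Section16B` (`varpi2`) and `Typed.Section16BLocal` (`locRatio`, `varpi2loc`);
0 new definitions, 0 named facts. ZHANG-L WP16 (typer T2″), helper under the RT-03 leaf `Eq16_16R2` /
Block A (`Step16_u031L` needs exactly the multiplicativity below).

## Content (§16 p. 93, tex L4597–L4599 "Note that `ϖ₂ⱼ(n)` is multiplicative"; App. A p. 105)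

* `calM2Factor_mul_eq`, `calM2Factor_eq_one_one_of_coprime` — LOCALITY: the Euler factor
  `F_q(d,l,s) = calM2Factor c′ χ q d l s` depends on `(d,l)` only through `[q∣d], [q∣l]` (from the
  tree's closed forms `AppendixA.lamTilde2_prime`, `AppendixA.xi2LocalSeries_prime`; `Re s > 0`).
* `norm_calM2Factor_one_one_sub_one_le`, `calM2Factor_one_one_ne_zero`, `multipliable_calM2Factor` —
  `‖F_q(1,1,s) − 1‖ ≤ 225·q^{−σ}/q` for `σ ≥ 9/10` (tree `AppendixA.norm_locF_sub_one_le`), hence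
  `F_q(1,1,s) ≠ 0` for `q ≥ 226`, and the Euler product `∏'_q F_q(d,l,s)` CONVERGES (`Multipliable`) for
  every `d, l ≥ 1` and `σ ≥ 9/10` — the convergence half of §16.u021 at `σ ≥ 9/10` incl. the line
  `σ = 1` where (16.10)–(16.13) use `𝓜₂`.
* `calM2_mul_eq_mul_prod_locRatio` — for `(d₁l₁, dl) = 1` and `F_q(1,1,s) ≠ 0` at the primes `q ∣ dl`:
  `𝓜₂(d₁d, l₁l; s) = 𝓜₂(d₁,l₁;s)·∏_{q∣dl} F_q(d,l,s)/F_q(1,1,s)` (splitting both unconditional products at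
  the finite set of primes dividing `dl`, `Literature.NumberTheory.Automorphic.prod_mul_tprod_compl_of_multipliable`);
  in particular (`d₁ = l₁ = 1`) `𝓜₂(d,l;s) = 𝓜₂(1,1;s)·∏_{q∣dl} locRatio`.
* `varpi2_mul_of_coprime` — **`ϖ₂ⱼ(n₁n) = ϖ₂ⱼ(n₁)·ϖ₂ⱼ^loc(n)`** for `(n₁,n) = 1`, whenever
  `F_q(1,1,1−βⱼ) ≠ 0` for the primes `q ∣ n`; `varpi2loc_mul_of_coprime` — `ϖ₂ⱼ^loc` is multiplicative
  over coprime arguments; `varpi2_mul_of_coprime_frakq` — the eventual form the Block-A displays use: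
  for all large `D`, all `j`, and `n₁, n` with `n` coprime to `n₁` and to `𝔮 = ∏_{q<D⁴} q`:
  `varpi2 c′ χ j (n₁*n) = varpi2 c′ χ j n₁ * varpi2loc c′ χ j n` (no Assumption (A) needed).

Why the local factor and not `ϖ₂ⱼ` itself (F16B-1): for `χ(2) = 1` the normaliser `𝓜₂*` drops the
`q = 2` factor, so `ϖ₂ⱼ(1) = F₂(1,1,1−βⱼ)/2 ≈ 0 ≠ 1` and `ϖ₂ⱼ` is NOT multiplicative as a function; the
manuscript's App. A records «`Π₂(l) = 0` if `χ(2) = (l,2) = 1`» (tex L5236).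

## References
* Y. Zhang, arXiv:2211.02515v1 (2022), §16 pp. 91–93 (u021, (16.13), tex L4537–L4599); App. A p. 105
  (tex L5194–L5237). [cite: Zhang2022LandauSiegel, §16 p.93, App. A p.105]
-/

noncomputable section

open Complex Real Filter Topology
open Literature.NumberTheory.LFunctions.Zhang2022
open Literature.NumberTheory.LFunctions.Zhang2022.Skeleton
open Literature.NumberTheory.LFunctions.Zhang2022.Typed.Section16A

namespace Literature.NumberTheory.LFunctions.Zhang2022.Typed.Section16B

variable (c' : ℝ) {D : ℕ} (χ : DirichletCharacter ℂ D)

/-! ## §1. Locality of the Euler factors `F_q(d,l,s)` -/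

/-- For a prime `q` and `Re s > 0` one has `‖q^{−s}‖ < 1`. [folklore] -/
private theorem norm_cpow_neg_lt_one {q : ℕ} (hq : q.Prime) {s : ℂ} (hs : 0 < s.re) :
    ‖(q : ℂ) ^ (-s)‖ < 1 := by
  have hq1 : (1 : ℝ) < q := by exact_mod_cast hq.one_lt
  rw [Complex.norm_natCast_cpow_of_pos hq.pos, Complex.neg_re]
  exact Real.rpow_lt_one_of_one_lt_of_neg hq1 (by linarith)

/-- **Locality**: multiplying `(d,l)` by a pair `(d′,l′)` coprime to the prime `q` does not change the
Euler factor `F_q(d,l,s) = calM2Factor c′ χ q d l s` (`Re s > 0`): by the closed forms of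
`λ̃₂(q,·)` and `Σ_r ξ₂(qʳ;·,·)q^{−rs}` (App. A p. 105; tree `AppendixA.lamTilde2_prime`,
`AppendixA.xi2LocalSeries_prime`) the factor depends on `(d,l)` only through `[q∣d]`, `[q∣l]`.
[cite: Zhang2022LandauSiegel, App. A p.105] -/
theorem calM2Factor_mul_eq {q : ℕ} (hq : q.Prime) (d l : ℕ) {d' l' : ℕ}
    (hd' : Nat.Coprime q d') (hl' : Nat.Coprime q l') {s : ℂ} (hs : 0 < s.re) :
    calM2Factor c' χ q (d * d') (l * l') s = calM2Factor c' χ q d l s := by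
  have hx := norm_cpow_neg_lt_one hq hs
  have hdd : Nat.Coprime q (d * d') ↔ Nat.Coprime q d := by
    rw [Nat.coprime_mul_iff_right]; exact ⟨fun h => h.1, fun h => ⟨h, hd'⟩⟩
  have hll : Nat.Coprime q (l * l') ↔ Nat.Coprime q l := by
    rw [Nat.coprime_mul_iff_right]; exact ⟨fun h => h.1, fun h => ⟨h, hl'⟩⟩
  unfold calM2Factor
  rw [AppendixA.lamTilde2_prime c' χ hq (d * d'), AppendixA.lamTilde2_prime c' χ hq d,
    AppendixA.xi2LocalSeries_prime c' χ hq (d * d') (l * l') s hx,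
    AppendixA.xi2LocalSeries_prime c' χ hq d l s hx]
  simp only [hdd, hll]

/-- **Locality at a prime not dividing `dl`**: `F_q(d,l,s) = F_q(1,1,s)` (`Re s > 0`).
[cite: Zhang2022LandauSiegel, App. A p.105] -/
theorem calM2Factor_eq_one_one_of_coprime {q : ℕ} (hq : q.Prime) {d l : ℕ}
    (hd : Nat.Coprime q d) (hl : Nat.Coprime q l) {s : ℂ} (hs : 0 < s.re) :
    calM2Factor c' χ q d l s = calM2Factor c' χ q 1 1 s := by
  have h := calM2Factor_mul_eq c' χ hq 1 1 hd hl hs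
  rwa [one_mul, one_mul] at h

/-- The local ratio `locRatio q d l s = F_q(d,l,s)/F_q(1,1,s)` is unchanged under `(d,l) ↦ (dd′,ll′)`
with `(q, d′l′) = 1` (`Re s > 0`). [cite: Zhang2022LandauSiegel, App. A p.105] -/
theorem locRatio_mul_eq {q : ℕ} (hq : q.Prime) (d l : ℕ) {d' l' : ℕ}
    (hd' : Nat.Coprime q d') (hl' : Nat.Coprime q l') {s : ℂ} (hs : 0 < s.re) :
    locRatio c' χ q (d * d') (l * l') s = locRatio c' χ q d l s := by
  unfold locRatio
  rw [calM2Factor_mul_eq c' χ hq d l hd' hl' hs]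

/-- The finite product of local ratios splits over coprime pairs: for `(d₁l₁, d₂l₂) = 1`,
`∏_{q∣d₁d₂l₁l₂} locRatio(q; d₁d₂, l₁l₂) = ∏_{q∣d₁l₁} locRatio(q;d₁,l₁) · ∏_{q∣d₂l₂} locRatio(q;d₂,l₂)`
(`Re s > 0`). [cite: Zhang2022LandauSiegel, §16 p.93] -/
theorem prod_locRatio_mul {d₁ l₁ d₂ l₂ : ℕ} (hcop : Nat.Coprime (d₁ * l₁) (d₂ * l₂))
    {s : ℂ} (hs : 0 < s.re) :
    ∏ q ∈ (d₁ * d₂ * (l₁ * l₂)).primeFactors, locRatio c' χ q (d₁ * d₂) (l₁ * l₂) s =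
      (∏ q ∈ (d₁ * l₁).primeFactors, locRatio c' χ q d₁ l₁ s) *
        ∏ q ∈ (d₂ * l₂).primeFactors, locRatio c' χ q d₂ l₂ s := by
  have e : d₁ * d₂ * (l₁ * l₂) = (d₁ * l₁) * (d₂ * l₂) := by ring
  rw [e, Nat.Coprime.primeFactors_mul hcop, Finset.prod_union hcop.disjoint_primeFactors]
  congr 1
  · refine Finset.prod_congr rfl fun q hq => ?_
    have hqp := Nat.prime_of_mem_primeFactors hq
    have hc2 : Nat.Coprime q (d₂ * l₂) :=
      Nat.Coprime.coprime_dvd_left (Nat.dvd_of_mem_primeFactors hq) hcop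
    exact locRatio_mul_eq c' χ hqp d₁ l₁ (Nat.Coprime.coprime_mul_right_right hc2)
      (Nat.Coprime.coprime_mul_left_right hc2) hs
  · refine Finset.prod_congr rfl fun q hq => ?_
    have hqp := Nat.prime_of_mem_primeFactors hq
    have hc1 : Nat.Coprime q (d₁ * l₁) :=
      Nat.Coprime.coprime_dvd_left (Nat.dvd_of_mem_primeFactors hq) hcop.symm
    rw [mul_comm d₁ d₂, mul_comm l₁ l₂]
    exact locRatio_mul_eq c' χ hqp d₂ l₂ (Nat.Coprime.coprime_mul_right_right hc1)
      (Nat.Coprime.coprime_mul_left_right hc1) hs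

/-- `λ₂(mn,s) = λ₂(m,s)λ₂(n,s)` for `(m,n) = 1` ((16.u014): a product over the prime factors).
[cite: Zhang2022LandauSiegel, §16 p.90 (u014)] -/
theorem lam2_mul_of_coprime {m n : ℕ} (hmn : Nat.Coprime m n) (s : ℂ) :
    lam2 c' χ (m * n) s = lam2 c' χ m s * lam2 c' χ n s := by
  unfold lam2
  rw [Nat.Coprime.primeFactors_mul hmn, Finset.prod_union hmn.disjoint_primeFactors]

/-! ## §2. `‖F_q(1,1,s) − 1‖ ≤ 225q^{−σ}/q`, non-vanishing, and convergence of the Euler products -/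

/-- **`‖F_q(1,1,s) − 1‖ ≤ 225·q^{−σ}/q`** for a prime `q` and `σ = Re s ≥ 9/10` (tree:
`AppendixA.calM2Factor_prime_one_one` = the closed form `locF`, and `AppendixA.norm_locF_sub_one_le`;
§16 p. 91 "`1 + O(q^{−19/10})`"). [cite: Zhang2022LandauSiegel, §16 p.91, App. A p.105] -/
theorem norm_calM2Factor_one_one_sub_one_le {q : ℕ} (hq : q.Prime) {s : ℂ} (hs : 9 / 10 ≤ s.re) :
    ‖calM2Factor c' χ q 1 1 s - 1‖ ≤ 225 * (q : ℝ) ^ (-s.re) / q := by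
  obtain ⟨ex, hx⟩ := AppendixA.norm_cpow_neg_le_three_fifths hq.two_le hs
  have hx1 : ‖(q : ℂ) ^ (-s)‖ < 1 := by linarith
  obtain ⟨hw, -⟩ := AppendixA.norm_cpow_neg_beta1 c' (D := D) hq.pos
  rw [AppendixA.calM2Factor_prime_one_one c' χ hq s hx1, ← ex]
  exact AppendixA.norm_locF_sub_one_le (DirichletCharacter.norm_le_one χ _) hw.le hx hq.two_le

/-- **`F_q(1,1,s) ≠ 0` for every prime `q ≥ 226`**, `Re s ≥ 9/10` (`‖F − 1‖ ≤ 225/q < 1`).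
[cite: Zhang2022LandauSiegel, §16 p.91] -/
theorem calM2Factor_one_one_ne_zero {q : ℕ} (hq : q.Prime) (h226 : 226 ≤ q) {s : ℂ}
    (hs : 9 / 10 ≤ s.re) : calM2Factor c' χ q 1 1 s ≠ 0 := by
  intro h0
  have h := norm_calM2Factor_one_one_sub_one_le c' χ hq hs
  rw [h0, zero_sub, norm_neg, norm_one] at h
  have hq0 : (0 : ℝ) < q := by exact_mod_cast hq.pos
  have hq1 : (1 : ℝ) ≤ q := by exact_mod_cast hq.one_lt.le
  have hrpow : (q : ℝ) ^ (-s.re) ≤ 1 :=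
    Real.rpow_le_one_of_one_le_of_nonpos hq1 (by linarith)
  have h226' : (226 : ℝ) ≤ q := by exact_mod_cast h226
  have : 225 * (q : ℝ) ^ (-s.re) / q < 1 := by
    rw [div_lt_one hq0]
    nlinarith
  linarith

/-- The Euler product of `𝓜₂(1,1;s)` converges absolutely for `Re s ≥ 9/10`:
`Σ_q ‖F_q(1,1,s) − 1‖ < ∞` (comparison with `225·Σ_q q^{−19/10}`).
[cite: Zhang2022LandauSiegel, §16 p.91 (u021)] -/
theorem summable_norm_calM2Factor_one_one_sub_one {s : ℂ} (hs : 9 / 10 ≤ s.re) :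
    Summable fun q : Nat.Primes => ‖calM2Factor c' χ (q : ℕ) 1 1 s - 1‖ := by
  have hsum : Summable fun q : Nat.Primes => 225 * ((q : ℕ) : ℝ) ^ (-(19 / 10 : ℝ)) :=
    (Nat.Primes.summable_rpow.mpr (by norm_num)).mul_left 225
  refine Summable.of_nonneg_of_le (fun _ => norm_nonneg _) (fun q => ?_) hsum
  have hq := q.prop
  have hq2 : (2 : ℝ) ≤ (q : ℕ) := by exact_mod_cast hq.two_le
  have hq0 : (0 : ℝ) < (q : ℕ) := by linarith
  have hq1 : (1 : ℝ) ≤ (q : ℕ) := by linarith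
  refine (norm_calM2Factor_one_one_sub_one_le c' χ hq hs).trans ?_
  rw [mul_div_assoc]
  refine mul_le_mul_of_nonneg_left ?_ (by norm_num)
  rw [div_eq_mul_inv, ← Real.rpow_neg_one, ← Real.rpow_add hq0]
  exact Real.rpow_le_rpow_of_exponent_le hq1 (by linarith)

/-- **The Euler product of `𝓜₂(d,l;s)` converges** (`Multipliable`) for all `d, l ≥ 1` and
`Re s ≥ 9/10` — the convergence content of §16.u021 on the closed half-plane `σ ≥ 9/10` (the factors
at the finitely many primes `q ∣ dl` are arbitrary; all others are the factors of `𝓜₂(1,1;s)`).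
[cite: Zhang2022LandauSiegel, §16 p.91 (u021)] -/
theorem multipliable_calM2Factor {d l : ℕ} (hd : d ≠ 0) (hl : l ≠ 0) {s : ℂ} (hs : 9 / 10 ≤ s.re) :
    Multipliable fun q : Nat.Primes => calM2Factor c' χ (q : ℕ) d l s := by
  classical
  have hs0 : 0 < s.re := by linarith
  -- work at the type `Subtype Nat.Prime` (= `Nat.Primes` by definition)
  set S : Finset (Subtype Nat.Prime) := (d * l).primeFactors.subtype Nat.Prime with hS
  have hdl : d * l ≠ 0 := Nat.mul_ne_zero hd hl
  have hmemS : ∀ q : Subtype Nat.Prime, q ∈ S ↔ (q : ℕ) ∣ d * l := by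
    intro q
    rw [hS, Finset.mem_subtype, Nat.mem_primeFactors]
    exact ⟨fun h => h.2.1, fun h => ⟨q.prop, h, hdl⟩⟩
  -- the deviation from `1`, split at `S`
  set g : Subtype Nat.Prime → ℝ := fun q => ‖calM2Factor c' χ (q : ℕ) d l s - 1‖ with hg
  have hoff : ∀ q : Subtype Nat.Prime, q ∉ S → g q = ‖calM2Factor c' χ (q : ℕ) 1 1 s - 1‖ := by
    intro q hq
    have hndvd : ¬ (q : ℕ) ∣ d * l := (hmemS q).not.mp hq
    have hcop : Nat.Coprime (q : ℕ) (d * l) := (Nat.Prime.coprime_iff_not_dvd q.prop).mpr hndvd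
    rw [hg]
    simp only
    rw [calM2Factor_eq_one_one_of_coprime c' χ q.prop (Nat.Coprime.coprime_mul_right_right hcop)
      (Nat.Coprime.coprime_mul_left_right hcop) hs0]
  have hsum0 : Summable fun q : Subtype Nat.Prime => ‖calM2Factor c' χ (q : ℕ) 1 1 s - 1‖ :=
    summable_norm_calM2Factor_one_one_sub_one c' χ hs
  have hsum : Summable g := by
    have h1 : Summable fun q : Subtype Nat.Prime => if q ∈ S then g q else 0 := by
      refine summable_of_ne_finset_zero (s := S) fun q hq => ?_
      rw [if_neg hq]
    have h2 : Summable fun q : Subtype Nat.Prime => if q ∈ S then (0 : ℝ) else g q := by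
      refine Summable.of_nonneg_of_le (fun q => ?_) (fun q => ?_) hsum0
      · split_ifs
        · exact le_rfl
        · exact norm_nonneg _
      · split_ifs with hq
        · exact norm_nonneg _
        · rw [hoff q hq]
    refine (h1.add h2).congr fun q => ?_
    split_ifs <;> simp
  have h : Multipliable fun q : Subtype Nat.Prime => 1 + (calM2Factor c' χ (q : ℕ) d l s - 1) :=
    multipliable_one_add_of_summable hsum
  have h' : Multipliable fun q : Subtype Nat.Prime => calM2Factor c' χ (q : ℕ) d l s := by
    simpa only [add_sub_cancel] using h
  exact h'

/-! ## §3. Splitting `𝓜₂` at the primes dividing `dl`: `𝓜₂(d₁d,l₁l) = 𝓜₂(d₁,l₁)·∏_{q∣dl} locRatio` -/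

/-- **The ratio structure of `𝓜₂`** (App. A p. 105, the mechanism of "`ϖ₂ⱼ` is multiplicative"): for
`(d₁l₁, dl) = 1`, all of `d₁, l₁, d, l ≥ 1`, `Re s ≥ 9/10`, and `F_q(1,1,s) ≠ 0` at every prime `q ∣ dl`,
`𝓜₂(d₁d, l₁l; s) = 𝓜₂(d₁,l₁;s) · ∏_{q∣dl} F_q(d,l,s)/F_q(1,1,s)`. Proof: both unconditional products
converge (`multipliable_calM2Factor`); their factors agree at every `q ∤ dl` (locality) and at `q ∣ dl`
they are `F_q(d,l,s)` resp. `F_q(1,1,s)` (locality again, `(q,d₁l₁) = 1`); split both at the finite set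
`{q ∣ dl}` (`Literature.NumberTheory.Automorphic.prod_mul_tprod_compl_of_multipliable`, the tail product
being multipliable because the finite product `∏_{q∣dl}F_q(1,1,s)` is a unit).
[cite: Zhang2022LandauSiegel, §16 p.93, App. A p.105] -/
theorem calM2_mul_eq_mul_prod_locRatio {d₁ l₁ d l : ℕ} (hd₁ : d₁ ≠ 0) (hl₁ : l₁ ≠ 0)
    (hd : d ≠ 0) (hl : l ≠ 0) (hcop : Nat.Coprime (d₁ * l₁) (d * l)) {s : ℂ} (hs : 9 / 10 ≤ s.re)
    (hne : ∀ q ∈ (d * l).primeFactors, calM2Factor c' χ q 1 1 s ≠ 0) :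
    calM2 c' χ (d₁ * d) (l₁ * l) s =
      calM2 c' χ d₁ l₁ s * ∏ q ∈ (d * l).primeFactors, locRatio c' χ q d l s := by
  classical
  have hs0 : 0 < s.re := by linarith
  -- work at the type `Subtype Nat.Prime` (= `Nat.Primes` by definition)
  set F : Subtype Nat.Prime → ℂ := fun q => calM2Factor c' χ (q : ℕ) (d₁ * d) (l₁ * l) s with hF
  set F₀ : Subtype Nat.Prime → ℂ := fun q => calM2Factor c' χ (q : ℕ) d₁ l₁ s with hF₀
  have hmul₀ : Multipliable F₀ := multipliable_calM2Factor c' χ hd₁ hl₁ hs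
  set S : Finset (Subtype Nat.Prime) := (d * l).primeFactors.subtype Nat.Prime with hS
  have hdl : d * l ≠ 0 := Nat.mul_ne_zero hd hl
  have hmemS : ∀ q : Subtype Nat.Prime, q ∈ S ↔ (q : ℕ) ∣ d * l := by
    intro q
    rw [hS, Finset.mem_subtype, Nat.mem_primeFactors]
    exact ⟨fun h => h.2.1, fun h => ⟨q.prop, h, hdl⟩⟩
  -- off `S` the factors agree
  have hFF₀ : ∀ q : Subtype Nat.Prime, q ∉ S → F q = F₀ q := by
    intro q hq
    have hndvd : ¬ (q : ℕ) ∣ d * l := (hmemS q).not.mp hq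
    have hc : Nat.Coprime (q : ℕ) (d * l) := (Nat.Prime.coprime_iff_not_dvd q.prop).mpr hndvd
    exact calM2Factor_mul_eq c' χ q.prop d₁ l₁ (Nat.Coprime.coprime_mul_right_right hc)
      (Nat.Coprime.coprime_mul_left_right hc) hs0
  -- on `S` the factors are `F_q(d,l)` resp. `F_q(1,1)`
  have hcopS : ∀ q : Subtype Nat.Prime, q ∈ S → Nat.Coprime (q : ℕ) (d₁ * l₁) := by
    intro q hq
    exact Nat.Coprime.coprime_dvd_left ((hmemS q).mp hq) hcop.symm
  have hF₀S : ∀ q : Subtype Nat.Prime, q ∈ S → F₀ q = calM2Factor c' χ (q : ℕ) 1 1 s := by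
    intro q hq
    have hc := hcopS q hq
    exact calM2Factor_eq_one_one_of_coprime c' χ q.prop (Nat.Coprime.coprime_mul_right_right hc)
      (Nat.Coprime.coprime_mul_left_right hc) hs0
  have hFS : ∀ q : Subtype Nat.Prime, q ∈ S → F q = calM2Factor c' χ (q : ℕ) d l s := by
    intro q hq
    have hc := hcopS q hq
    have h := calM2Factor_mul_eq c' χ q.prop d l (d' := d₁) (l' := l₁)
      (Nat.Coprime.coprime_mul_right_right hc) (Nat.Coprime.coprime_mul_left_right hc) hs0
    rw [hF]
    simp only
    rw [mul_comm d₁ d, mul_comm l₁ l, h]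
  have hM₀ : calM2 c' χ d₁ l₁ s = ∏' q, F₀ q := rfl
  have hM : calM2 c' χ (d₁ * d) (l₁ * l) s = ∏' q, F q := rfl
  -- the finite product `∏_S F₀` is a unit
  have hPS : ∏ q ∈ S, F₀ q ≠ 0 := by
    refine Finset.prod_ne_zero_iff.mpr fun q hq => ?_
    rw [hF₀S q hq]
    refine hne q ?_
    exact Nat.mem_primeFactors.mpr ⟨q.prop, (hmemS q).mp hq, hdl⟩
  have hc₀ : Multipliable (F₀ ∘ (↑) : ↥((↑S : Set (Subtype Nat.Prime))ᶜ) → ℂ) :=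
    Literature.NumberTheory.Automorphic.multipliable_compl_of_isUnit_prod S hmul₀ (Ne.isUnit hPS)
  have hcompl : ∀ q : ↥((↑S : Set (Subtype Nat.Prime))ᶜ),
      F (q : Subtype Nat.Prime) = F₀ (q : Subtype Nat.Prime) := by
    intro q
    refine hFF₀ q ?_
    have hq := q.prop
    rwa [Set.mem_compl_iff, Finset.mem_coe] at hq
  have hc : Multipliable (F ∘ (↑) : ↥((↑S : Set (Subtype Nat.Prime))ᶜ) → ℂ) := by
    refine hc₀.congr fun q => ?_
    simp only [Function.comp_apply]
    exact (hcompl q).symm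
  have hsplit₀ := Literature.NumberTheory.Automorphic.prod_mul_tprod_compl_of_multipliable S hc₀
  have hsplit := Literature.NumberTheory.Automorphic.prod_mul_tprod_compl_of_multipliable S hc
  have hR : ∏' q : ↥((↑S : Set (Subtype Nat.Prime))ᶜ), F q =
      ∏' q : ↥((↑S : Set (Subtype Nat.Prime))ᶜ), F₀ q :=
    tprod_congr fun q => hcompl q
  -- `∏_S F = ∏_S F₀ · ∏_S locRatio`
  have hSprod : ∏ q ∈ S, F q = (∏ q ∈ S, F₀ q) * ∏ q ∈ S, locRatio c' χ (q : ℕ) d l s := by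
    rw [← Finset.prod_mul_distrib]
    refine Finset.prod_congr rfl fun q hq => ?_
    rw [hFS q hq, hF₀S q hq, locRatio]
    have hne' : calM2Factor c' χ (q : ℕ) 1 1 s ≠ 0 := by
      rw [← hF₀S q hq]; exact (Finset.prod_ne_zero_iff.mp hPS) q hq
    field_simp
  rw [hM, hM₀, ← hsplit, ← hsplit₀, hR, hSprod]
  -- rewrite the product over `S` as a product over `(dl).primeFactors ⊆ ℕ`
  have hSN : ∏ q ∈ S, locRatio c' χ (q : ℕ) d l s =
      ∏ q ∈ (d * l).primeFactors, locRatio c' χ q d l s := by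
    rw [hS]
    exact Finset.prod_subtype_of_mem (fun n : ℕ => locRatio c' χ n d l s)
      fun q hq => Nat.prime_of_mem_primeFactors hq
  rw [hSN]
  ring

/-- **(15.18)-type ratio formula for `𝓜₂`**: `𝓜₂(d,l;s) = 𝓜₂(1,1;s)·∏_{q∣dl} F_q(d,l,s)/F_q(1,1,s)` for
`d, l ≥ 1`, `Re s ≥ 9/10`, whenever `F_q(1,1,s) ≠ 0` at the primes `q ∣ dl`.
[cite: Zhang2022LandauSiegel, §16 p.93, App. A p.105] -/
theorem calM2_eq_one_one_mul_prod_locRatio {d l : ℕ} (hd : d ≠ 0) (hl : l ≠ 0) {s : ℂ}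
    (hs : 9 / 10 ≤ s.re) (hne : ∀ q ∈ (d * l).primeFactors, calM2Factor c' χ q 1 1 s ≠ 0) :
    calM2 c' χ d l s = calM2 c' χ 1 1 s * ∏ q ∈ (d * l).primeFactors, locRatio c' χ q d l s := by
  have h := calM2_mul_eq_mul_prod_locRatio c' χ one_ne_zero one_ne_zero hd hl
    (by rw [one_mul]; exact Nat.coprime_one_left _) hs hne
  rwa [one_mul, one_mul] at h

/-! ## §4. The multiplicativity `ϖ₂ⱼ(n₁n) = ϖ₂ⱼ(n₁)·ϖ₂ⱼ^loc(n)` -/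

/-- The divisor pairs of `mn`, `(m,n) = 1`, are the products of the divisor pairs of `m` and of `n`.
[folklore] -/
private theorem sum_divisorsAntidiagonal_mul_of_coprime' {M : Type*} [AddCommMonoid M] {m n : ℕ}
    (hmn : m.Coprime n) (f : ℕ × ℕ → M) :
    ∑ w ∈ (m * n).divisorsAntidiagonal, f w =
      ∑ x ∈ m.divisorsAntidiagonal, ∑ y ∈ n.divisorsAntidiagonal, f (x.1 * y.1, x.2 * y.2) := by
  rw [← Finset.sum_product']
  symm
  apply Finset.sum_nbij fun ((i, j), k, l) ↦ (i * k, j * l)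
  · rintro ⟨⟨a1, a2⟩, ⟨b1, b2⟩⟩ h
    simp only [Nat.mem_divisorsAntidiagonal, Ne, Finset.mem_product] at h
    rcases h with ⟨⟨rfl, ha⟩, ⟨rfl, hb⟩⟩
    simp only [Nat.mem_divisorsAntidiagonal, mul_eq_zero, Ne]
    constructor
    · ring
    rw [mul_eq_zero] at *
    exact not_or_intro ha hb
  · simp only [Set.InjOn, Finset.mem_coe, Nat.mem_divisorsAntidiagonal, Finset.mem_product, Prod.mk_inj]
    rintro ⟨⟨a1, a2⟩, ⟨b1, b2⟩⟩ ⟨⟨rfl, ha⟩, ⟨rfl, hb⟩⟩ ⟨⟨c1, c2⟩, ⟨d1, d2⟩⟩ hcd h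
    have cop := hmn
    ext
    · trans Nat.gcd (a1 * a2) (a1 * b1)
      · rw [Nat.gcd_mul_left, cop.coprime_mul_left.coprime_mul_right_right.gcd_eq_one, mul_one]
      · rw [← hcd.1.1, ← hcd.2.1] at cop
        rw [← hcd.1.1, h.1, Nat.gcd_mul_left,
          cop.coprime_mul_left.coprime_mul_right_right.gcd_eq_one, mul_one]
    · trans Nat.gcd (a1 * a2) (a2 * b2)
      · rw [mul_comm, Nat.gcd_mul_left, cop.coprime_mul_right.coprime_mul_left_right.gcd_eq_one,
          mul_one]
      · rw [← hcd.1.1, ← hcd.2.1] at cop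
        rw [← hcd.1.1, h.2, mul_comm, Nat.gcd_mul_left,
          cop.coprime_mul_right.coprime_mul_left_right.gcd_eq_one, mul_one]
    · trans Nat.gcd (b1 * b2) (a1 * b1)
      · rw [mul_comm, Nat.gcd_mul_right,
          cop.coprime_mul_right.coprime_mul_left_right.symm.gcd_eq_one, one_mul]
      · rw [← hcd.1.1, ← hcd.2.1] at cop
        rw [← hcd.2.1, h.1, mul_comm c1 d1, Nat.gcd_mul_left,
          cop.coprime_mul_right.coprime_mul_left_right.symm.gcd_eq_one, mul_one]
    · trans Nat.gcd (b1 * b2) (a2 * b2)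
      · rw [Nat.gcd_mul_right, cop.coprime_mul_left.coprime_mul_right_right.symm.gcd_eq_one, one_mul]
      · rw [← hcd.1.1, ← hcd.2.1] at cop
        rw [← hcd.2.1, h.2, Nat.gcd_mul_right,
          cop.coprime_mul_left.coprime_mul_right_right.symm.gcd_eq_one, one_mul]
  · simp only [Set.SurjOn, Set.subset_def, Finset.mem_coe, Nat.mem_divisorsAntidiagonal,
      Finset.mem_product, Set.mem_image]
    rintro ⟨b1, b2⟩ h
    use ((b1.gcd m, b2.gcd m), (b1.gcd n, b2.gcd n))
    rw [← hmn.gcd_mul _, ← hmn.gcd_mul _, ← h.1, Nat.gcd_mul_gcd_of_coprime_of_mul_eq_mul hmn h.1,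
      Nat.gcd_mul_gcd_of_coprime_of_mul_eq_mul hmn.symm _]
    · rw [Ne, mul_eq_zero, not_or] at h
      simp [h.2.1, h.2.2]
    rw [mul_comm n m, h.1]
  · rintro ⟨⟨a1, a2⟩, ⟨b1, b2⟩⟩ _
    rfl

/-- Components of a divisor pair are non-zero. [folklore] -/
private theorem ne_zero_of_mem_divisorsAntidiagonal {n : ℕ} {x : ℕ × ℕ}
    (hx : x ∈ n.divisorsAntidiagonal) : x.1 ≠ 0 ∧ x.2 ≠ 0 := by
  have h := Nat.mem_divisorsAntidiagonal.mp hx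
  exact ⟨fun h0 => h.2 (by rw [← h.1, h0, zero_mul]), fun h0 => h.2 (by rw [← h.1, h0, mul_zero])⟩

/-- `Re(1 − βⱼ) = 1`. [cite: Zhang2022LandauSiegel, §2 (2.13)] -/
theorem one_sub_betaJ_re (D j : ℕ) : (1 - betaJ c' D j).re = 1 := by
  rw [Complex.sub_re, Complex.one_re, betaJ_re_eq_zero]; norm_num

/-- **"`ϖ₂ⱼ(n)` is multiplicative" in kernel form (F16B-1)**: for `n₁, n` coprime, if the Euler
factor `F_q(1,1,1−βⱼ)` of `𝓜₂(1,1;·)` is non-zero at every prime `q ∣ n`, then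
`ϖ₂ⱼ(n₁n) = ϖ₂ⱼ(n₁)·ϖ₂ⱼ^loc(n)` (`varpi2 = Typed.Section16B.varpi2`, `varpi2loc = Typed.Section16B.varpi2loc`):
the divisor pairs of `n₁n` are the products of those of `n₁` and `n`, `λ₂`, `d ↦ d^{βⱼ}`, `χ` are
multiplicative, and `𝓜₂(d₁d,l₁l;1−βⱼ) = 𝓜₂(d₁,l₁;1−βⱼ)·∏_{q∣dl} locRatio` (`calM2_mul_eq_mul_prod_locRatio`);
the global normaliser `𝓜₂*(1−βⱼ)` rides along unchanged. [cite: Zhang2022LandauSiegel, §16 p.93] -/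
theorem varpi2_mul_of_coprime [NeZero D] (j : ℕ) {n₁ n : ℕ} (hcop : Nat.Coprime n₁ n)
    (hne : ∀ q ∈ n.primeFactors, calM2Factor c' χ q 1 1 (1 - betaJ c' D j) ≠ 0) :
    varpi2 c' χ j (n₁ * n) = varpi2 c' χ j n₁ * varpi2loc c' χ j n := by
  have hsre : 9 / 10 ≤ (1 - betaJ c' D j).re := by rw [one_sub_betaJ_re]; norm_num
  unfold varpi2 varpi2loc
  rw [sum_divisorsAntidiagonal_mul_of_coprime' hcop, Finset.sum_mul_sum]
  refine Finset.sum_congr rfl fun x hx => Finset.sum_congr rfl fun y hy => ?_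
  obtain ⟨hx1, hx2⟩ := ne_zero_of_mem_divisorsAntidiagonal hx
  obtain ⟨hy1, hy2⟩ := ne_zero_of_mem_divisorsAntidiagonal hy
  have hxe := (Nat.mem_divisorsAntidiagonal.mp hx).1
  have hye := (Nat.mem_divisorsAntidiagonal.mp hy).1
  have hcop' : Nat.Coprime (x.1 * x.2) (y.1 * y.2) := by rw [hxe, hye]; exact hcop
  have hcop1 : Nat.Coprime x.1 y.1 :=
    Nat.Coprime.coprime_dvd_left (Dvd.intro _ rfl) (Nat.Coprime.coprime_dvd_right (Dvd.intro _ rfl) hcop')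
  have hne' : ∀ q ∈ (y.1 * y.2).primeFactors, calM2Factor c' χ q 1 1 (1 - betaJ c' D j) ≠ 0 := by
    rw [hye]; exact hne
  simp only
  rw [calM2_mul_eq_mul_prod_locRatio c' χ hx1 hx2 hy1 hy2 hcop' hsre hne', hye,
    lam2_mul_of_coprime c' χ hcop1]
  push_cast
  rw [Complex.natCast_mul_natCast_cpow, map_mul]
  ring

/-- **`ϖ₂ⱼ^loc` is multiplicative over coprime arguments**: `ϖ₂ⱼ^loc(mn) = ϖ₂ⱼ^loc(m)ϖ₂ⱼ^loc(n)` for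
`(m,n) = 1` (finite products only; no convergence hypothesis). [cite: Zhang2022LandauSiegel, §16 p.93] -/
theorem varpi2loc_mul_of_coprime [NeZero D] (j : ℕ) {m n : ℕ} (hmn : Nat.Coprime m n) :
    varpi2loc c' χ j (m * n) = varpi2loc c' χ j m * varpi2loc c' χ j n := by
  have hs0 : 0 < (1 - betaJ c' D j).re := by rw [one_sub_betaJ_re]; norm_num
  unfold varpi2loc
  rw [sum_divisorsAntidiagonal_mul_of_coprime' hmn, Finset.sum_mul_sum]
  refine Finset.sum_congr rfl fun x hx => Finset.sum_congr rfl fun y hy => ?_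
  have hxe := (Nat.mem_divisorsAntidiagonal.mp hx).1
  have hye := (Nat.mem_divisorsAntidiagonal.mp hy).1
  have hcop' : Nat.Coprime (x.1 * x.2) (y.1 * y.2) := by rw [hxe, hye]; exact hmn
  have hcop1 : Nat.Coprime x.1 y.1 :=
    Nat.Coprime.coprime_dvd_left (Dvd.intro _ rfl) (Nat.Coprime.coprime_dvd_right (Dvd.intro _ rfl) hcop')
  simp only
  have hprod := prod_locRatio_mul c' χ (d₁ := x.1) (l₁ := x.2) (d₂ := y.1) (l₂ := y.2) hcop' hs0
  have e : x.1 * y.1 * (x.2 * y.2) = m * n := by rw [← hxe, ← hye]; ring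
  rw [e, hxe, hye] at hprod
  rw [hprod, lam2_mul_of_coprime c' χ hcop1]
  push_cast
  rw [Complex.natCast_mul_natCast_cpow, map_mul]
  ring

/-! ## §5. The eventual form used by the Block-A displays (`𝔮`-rough arguments) -/

/-- A prime divides `𝔮 = ∏_{q<D⁴} q` iff it is `< D⁴`. [cite: Zhang2022LandauSiegel, §15 p.86] -/
private theorem prime_dvd_frakq_iff' {D q : ℕ} (hq : q.Prime) : q ∣ frakq D ↔ q < D ^ 4 := by
  unfold frakq
  rw [(Nat.Prime.prime hq).dvd_finsetProd_iff]
  constructor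
  · rintro ⟨p, hp, hqp⟩
    rw [Finset.mem_filter, Finset.mem_range] at hp
    have := (Nat.prime_dvd_prime_iff_eq hq hp.2).mp hqp
    rw [this]; exact hp.1
  · intro h
    exact ⟨q, Finset.mem_filter.mpr ⟨Finset.mem_range.mpr h, hq⟩, dvd_rfl⟩

/-- If `(n,𝔮) = 1`, every prime factor of `n` is at least `D⁴`. [cite: Zhang2022LandauSiegel, §15 p.86] -/
theorem pow_four_le_of_mem_primeFactors_of_coprime_frakq' {D n q : ℕ}
    (hn : Nat.Coprime n (frakq D)) (hq : q ∈ n.primeFactors) : D ^ 4 ≤ q := by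
  have hqP := Nat.prime_of_mem_primeFactors hq
  have hqn := Nat.dvd_of_mem_primeFactors hq
  by_contra hlt
  have hqQ : q ∣ frakq D := (prime_dvd_frakq_iff' hqP).mpr (not_le.mp hlt)
  have h1 : q ∣ Nat.gcd n (frakq D) := Nat.dvd_gcd hqn hqQ
  rw [Nat.Coprime.gcd_eq_one hn] at h1
  exact hqP.one_lt.ne' (Nat.dvd_one.mp h1)

/-- **`ϖ₂ⱼ(n₁n) = ϖ₂ⱼ(n₁)·ϖ₂ⱼ^loc(n)` for `𝔮`-rough `n`** — the form in which u031–u037 use "`ϖ₂ⱼ` is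
multiplicative": for every `D ≥ 4`, every Dirichlet character `χ (mod D)`, every `j`, and `n₁, n` with `n`
coprime to `n₁` and to `𝔮` (so each prime `q ∣ n` has `q ≥ D⁴ ≥ 226`, where `F_q(1,1,1−βⱼ) ≠ 0`).
No Assumption (A), no primitivity. [cite: Zhang2022LandauSiegel, §16 p.93] -/
theorem varpi2_mul_varpi2loc_of_coprime_frakq [NeZero D] (hD : 4 ≤ D) (j : ℕ) {n₁ n : ℕ}
    (hcop : Nat.Coprime n₁ n) (hnq : Nat.Coprime n (frakq D)) :
    varpi2 c' χ j (n₁ * n) = varpi2 c' χ j n₁ * varpi2loc c' χ j n := by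
  refine varpi2_mul_of_coprime c' χ j hcop fun q hq => ?_
  have hqP := Nat.prime_of_mem_primeFactors hq
  have h4 := pow_four_le_of_mem_primeFactors_of_coprime_frakq' hnq hq
  have hD4 : 4 ^ 4 ≤ D ^ 4 := Nat.pow_le_pow_left hD 4
  refine calM2Factor_one_one_ne_zero c' χ hqP (by omega) ?_
  rw [one_sub_betaJ_re]; norm_num

/-- The same, packaged as an eventual statement over the lane's `ForAllLarge` (for all large `D`, every
real primitive `χ`; (A) not needed): for all `j, n₁, n` with `(n₁,n) = 1`, `(n,𝔮) = 1`,
`varpi2 c′ χ j (n₁*n) = varpi2 c′ χ j n₁ * varpi2loc c′ χ j n`. [cite: Zhang2022LandauSiegel, §16 p.93] -/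
theorem varpi2_mul_varpi2loc_eventually :
    ForAllLarge fun D _ χ => ∀ j n₁ n : ℕ, Nat.Coprime n₁ n → Nat.Coprime n (frakq D) →
      varpi2 c' χ j (n₁ * n) = varpi2 c' χ j n₁ * varpi2loc c' χ j n := by
  refine ⟨4, fun D _ χ hD _ _ j n₁ n hcop hnq => ?_⟩
  exact varpi2_mul_varpi2loc_of_coprime_frakq c' χ hD j hcop hnq

end Literature.NumberTheory.LFunctions.Zhang2022.Typed.Section16B
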